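import Summits.Ventures.CertifiedQuantumChemistry.Rows.HubbardRingTVEnergyFormula
import Summits.Ventures.CertifiedQuantumChemistry.Rows.HubbardRingTVWeakCoupling
import HarnessLib

/-!
# Ventures/CertifiedQuantumChemistry — Rows/HubbardRingTVBondCeiling.lean: THE FREE BOND CEILING OF THE
# RELAXATION — on the TV-H ring (`L ≥ 3`) the total bond sum of EVERY feasible pair of the level-DQG sector
# programme is at most the free-fermion value: `2t·Σ_p Σ_σ Re γ_{pσ,(p+1)σ} ≤ −E₀(L; t, 0; a, b)`; hence an
# optimiser's interaction energy is at most the rise of the value above the free energy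

HONEST FRAMING (verbatim): certified bounds for a stated model Hamiltonian in a stated basis; not a
claim about the real molecule beyond that model. Nothing here is a certificate, a row or a value of
record; the statements are about ARBITRARY feasible (resp. optimal) pairs of the abstract programme on the
cell's model object and its exact sector energies.

Seat rdm-B, ROWS courtesy file (theorems only; no `def`, no notation, no instance; zero compute). The
relaxation-side twin of this gen's `Rows/HubbardRingTVGroundStateEnergyPerSite.lean` §4 (the ground-state
bond amplitude is at most the free one): a feasible pair `(γ, Γ)` of the `(a, b)` programme is feasible at
EVERY coupling, in particular at `U = 0`, where its energy is the pure bond term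
`−2t·Σ_p Σ_σ Re γ_{pσ,(p+1)σ}` (this gen's ring energy formula) and the programme is EXACT (gen 38's
`hubbardRingTV_pqgSectorEnergy_zero_repulsion`: `OPT_DQG(L; t, 0; a, b) = E₀(L; t, 0; a, b)`):

* §1 **`hubbardRingTV_feasible_bondSum_le_free`** — `2t·Σ_p Σ_σ Re γ_{pσ,(p+1)σ} ≤ −E₀(L; t, 0; a, b)` for
  EVERY `(a, b)`-sector-feasible pair (`a, b ≤ L`, `L ≥ 3`; no optimality, no `U`): the D, Q, G conditions
  alone cap the kinetic energy of a pair by the free-fermion ground energy of the sector;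
  `hubbardRingTV_feasible_bond_le_free_site` — at a rotation-invariant pair, per site:
  `2t·L·Σ_σ Re γ_{p₀σ,(p₀+1)σ} ≤ −E₀(L; t, 0; a, b)`.
* §2 **`hubbardRingTV_optimal_interaction_le`** — at a pair OPTIMAL for `(t, U)`:
  `U·Σ_p Re Γ_{(p↑,p↓),(p↑,p↓)} ≤ OPT_DQG(L; t, U; a, b) − E₀(L; t, 0; a, b)` (the optimiser's interaction
  energy is at most the rise of the value above the free energy), and with `OPT_DQG ≤ E₀`
  (`hubbardRingTV_optimal_interaction_le_energy_sub`): `≤ E₀(L; t, U; a, b) − E₀(L; t, 0; a, b)`.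

All PROVED (0 sorry, standard axioms); no defs, no named facts. Tree (REUSED):
`RingEnergy.hubbardRingTV_re_rdmEnergy_eq_of_feasible` / `…_eq_mul_site` (this gen),
`hubbardRingTV_pqgSectorEnergy_zero_repulsion` (gen 38), `pqgSectorEnergy_le_rdmEnergy`,
`pqgSectorEnergy_le_sectorGroundEnergy`.
-/

noncomputable section

namespace Summit.Ventures.CertifiedQuantumChemistry

open Matrix Finset
open Literature.MathematicalPhysics.QuantumLattice Literature.MathematicalPhysics.QuantumChemistry
open Summit.Ventures.CertifiedQuantumChemistry.Hamiltonians
open scoped ComplexOrder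

namespace RingEnergy

open RingSymmetry

variable {L : ℕ} {γ : Matrix (Orb (Fin L)) (Orb (Fin L)) ℂ}
  {Γ : Matrix (Orb (Fin L) × Orb (Fin L)) (Orb (Fin L) × Orb (Fin L)) ℂ}

/-! ## §1 Every feasible pair's bond sum is below the free-fermion value -/

/-- **THE FREE BOND CEILING** (`L ≥ 3`, `a, b ≤ L`, every `t`): for EVERY feasible pair of the
`(a, b)`-sector level-DQG programme of the TV-H ring, `2t·Σ_p Σ_σ Re γ_{pσ,(p+1)σ} ≤ −E₀(hubbardRingTV L t 0; a, b)`
— the pair is feasible at `U = 0`, where its energy is `−2t·(bond sum)` and the programme is exact.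
[folklore] -/
theorem hubbardRingTV_feasible_bondSum_le_free (hL : 3 ≤ L) (t : ℚ) {a b : ℕ} (ha : a ≤ L) (hb : b ≤ L)
    (hf : IsDQGFeasibleSector a b γ Γ) :
    2 * (t : ℝ) * ∑ p : Fin L, ∑ σ : Fin 2, (γ (orb p σ) (orb (finRotate L p) σ)).re ≤
      -Model.energy (hubbardRingTV L t 0) a b := by
  have h0 := hubbardRingTV_re_rdmEnergy_eq_of_feasible hL t 0 hf
  have hle := pqgSectorEnergy_le_rdmEnergy (fun p q => ((hubbardRingTV L t 0).h p q : ℂ))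
    (fun p q r s => ((hubbardRingTV L t 0).eri p q r s : ℂ)) ((hubbardRingTV L t 0).ecore : ℂ) hf
  have hex := hubbardRingTV_pqgSectorEnergy_zero_repulsion L t ha hb
  unfold Model.pqgSectorEnergy at hex
  rw [hex, h0] at hle
  push_cast at hle
  linarith

/-- **Per site, at a rotation-invariant feasible pair**: `2t·L·Σ_σ Re γ_{p₀σ,(p₀+1)σ} ≤ −E₀(L; t, 0; a, b)`
for every site `p₀`. [folklore] -/
theorem hubbardRingTV_feasible_bond_le_free_site (hL : 3 ≤ L) (t : ℚ) {a b : ℕ} (ha : a ≤ L) (hb : b ≤ L)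
    (hf : IsDQGFeasibleSector a b γ Γ)
    (hγ : ∀ (p q : Fin L) (σ τ : Fin 2), γ (orb (finRotate L p) σ) (orb (finRotate L q) τ) = γ (orb p σ) (orb q τ))
    (p₀ : Fin L) :
    2 * (t : ℝ) * (L * ∑ σ : Fin 2, (γ (orb p₀ σ) (orb (finRotate L p₀) σ)).re) ≤
      -Model.energy (hubbardRingTV L t 0) a b := by
  have h := hubbardRingTV_feasible_bondSum_le_free hL t ha hb hf
  rw [Finset.sum_congr rfl fun p _ => Finset.sum_congr rfl fun σ _ =>
    congrArg Complex.re (one_bond_eq hγ p p₀ σ σ)] at h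
  simp only [Finset.sum_const, Finset.card_univ, Fintype.card_fin, nsmul_eq_mul] at h
  exact h

/-! ## §2 At an optimal pair: the interaction energy is at most the rise above the free energy -/

/-- **THE OPTIMISER's INTERACTION ENERGY** (`L ≥ 3`, `a, b ≤ L`, every `t, U`): at a pair OPTIMAL for the
`(a, b)` programme of `hubbardRingTV L t U`,
`U·Σ_p Re Γ_{(p↑,p↓),(p↑,p↓)} ≤ OPT_DQG(L; t, U; a, b) − E₀(L; t, 0; a, b)` (the value is `−2t·bonds + U·doublons`
and the bond term is at least the free energy by §1). [folklore] -/
theorem hubbardRingTV_optimal_interaction_le (hL : 3 ≤ L) (t U : ℚ) {a b : ℕ} (ha : a ≤ L) (hb : b ≤ L)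
    (hf : IsDQGFeasibleSector a b γ Γ)
    (hopt : (rdmEnergy (fun p q => ((hubbardRingTV L t U).h p q : ℂ))
        (fun p q r s => ((hubbardRingTV L t U).eri p q r s : ℂ)) ((hubbardRingTV L t U).ecore : ℂ) γ Γ).re =
      Model.pqgSectorEnergy (hubbardRingTV L t U) a b) :
    (U : ℝ) * ∑ p : Fin L, (Γ (orb p 0, orb p 1) (orb p 0, orb p 1)).re ≤
      Model.pqgSectorEnergy (hubbardRingTV L t U) a b - Model.energy (hubbardRingTV L t 0) a b := by
  have h := hubbardRingTV_feasible_bondSum_le_free hL t ha hb hf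
  rw [← hopt, hubbardRingTV_re_rdmEnergy_eq_of_feasible hL t U hf]
  linarith

/-- **… and below the exact energy rise**: `U·Σ_p Re d_p ≤ E₀(L; t, U; a, b) − E₀(L; t, 0; a, b)` at an
optimal pair (`OPT_DQG ≤ E₀`). [folklore] -/
theorem hubbardRingTV_optimal_interaction_le_energy_sub (hL : 3 ≤ L) (t U : ℚ) {a b : ℕ} (ha : a ≤ L)
    (hb : b ≤ L) (hf : IsDQGFeasibleSector a b γ Γ)
    (hopt : (rdmEnergy (fun p q => ((hubbardRingTV L t U).h p q : ℂ))
        (fun p q r s => ((hubbardRingTV L t U).eri p q r s : ℂ)) ((hubbardRingTV L t U).ecore : ℂ) γ Γ).re =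
      Model.pqgSectorEnergy (hubbardRingTV L t U) a b) :
    (U : ℝ) * ∑ p : Fin L, (Γ (orb p 0, orb p 1) (orb p 0, orb p 1)).re ≤
      Model.energy (hubbardRingTV L t U) a b - Model.energy (hubbardRingTV L t 0) a b := by
  have h := hubbardRingTV_optimal_interaction_le hL t U ha hb hf hopt
  have hle : Model.pqgSectorEnergy (hubbardRingTV L t U) a b ≤ Model.energy (hubbardRingTV L t U) a b :=
    pqgSectorEnergy_le_sectorGroundEnergy (hubbardRingTV_hamiltonian_isHermitian L t U)
      (by rw [Fintype.card_fin]; exact ha) (by rw [Fintype.card_fin]; exact hb)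
  linarith

end RingEnergy

end Summit.Ventures.CertifiedQuantumChemistry

end
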